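import Summits.QuantumFields.YangMills.Theorems.BalabanStepParabolic.Negative.NoContinuityJunk
import Summits.QuantumFields.YangMills.Theorems.BalabanStepParabolic.Negative.TorusRegularity
import Summits.QuantumFields.YangMills.Theorems.BalabanStepParabolic.Negative.CurvatureOnly
import Summits.QuantumFields.YangMills.Theorems.BalabanStepParabolic.Negative.TrivialGroup

/-!
# `BalabanStepParabolic` — negative-side support VIII: even block factors are dead weight

Support file for crux `stmt-QuantumFields-9684` (`ParabolicTrajectory.BalabanStepParabolic`), extracted from the
standing disprover's work file `Cruxes/BalabanStepParabolic/Disproof.lean` §B (cycle 2). Tree objects only.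

For EVEN `M` the covariance axiom (4a) links a torus of `S` sites to one of `M S` sites while the Wilson
identification (4b) speaks only about ODD tori `2L+1`; so `M ∤ 2L+1` and nothing is ever transported: the only
pinned points are the Wilson arc itself, and the continuity field (4c) reduces to FINITE-TORUS REGULARITY
(`TorusRegularity.lean`). `evenStep` / `nonempty_of_even`: for every compact `G`, every `r` and every even `M ≥ 2`
the FULL structure `BalabanBanachStep G r M` is inhabited — thin chart `E = ℝ`, `g ↦ g + (log M) g³`, `y ↦ y/2`,
`yW ≡ 1`, `betaOf = 1/g²`, normalisations `cInd` (curvature only), functional `expectE` built with `orbitRec` over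
the germ "Wilson data at `β = 1/g²`, continuously extended through `β = ∞`" (`continuous_extend`).
`balabanStepParabolic_iff_odd`: the crux is equivalent to its restriction to odd `M`;
`balabanStepParabolic_even_half`: its even half is a theorem. PLANNER: restate with `Odd M →` or let (4b) pin all tori.
-/

namespace Summit.QuantumFields.YangMills.Theorems.BalabanStepParabolic.Negative

open scoped SchwartzMap
open MeasureTheory Filter Topology
open Literature.MathematicalPhysics.QuantumFieldTheory Literature.MathematicalPhysics.AQFT
open Literature.MathematicalPhysics.QuantumLattice

noncomputable section

/-! ### §B  Even block factors: the full structure is junk-inhabited from finite-torus regularity -/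

section Even

variable {G : Type} [Group G] [TopologicalSpace G] [IsTopologicalGroup G] [CompactSpace G]
  [MeasurableSpace G] [BorelSpace G] (r : LatticeRep G)

/-- Regularity of the `cInd`-normalised centred functions (from finite-torus regularity). [folklore] -/
theorem regular_cInd (L n : ℕ) (σ : Fin n → YMSpecies G)
    (f : Fin n → 𝓢(EuclideanSpace ℝ (Fin 4), ℝ)) :
    ContinuousOn (fun β => wilsonCentredSchwinger r.ρ β L (cInd r) n σ f) (Set.Ioi 0) ∧
      ∃ ℓ : ℝ, Tendsto (fun β => wilsonCentredSchwinger r.ρ β L (cInd r) n σ f) atTop (𝓝 ℓ) := by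
  simp_rw [wilsonCentredSchwinger_cInd]
  by_cases h : ∀ i, σ i = r.curvature
  · simp_rw [if_pos h]
    exact ⟨(curvatureTorusRegular_holds' r L n f).1.continuousOn, (curvatureTorusRegular_holds' r L n f).2⟩
  · simp_rw [if_neg h]; exact ⟨continuousOn_const, 0, tendsto_const_nhds⟩

/-- `1/t² → ∞` as `t → 0⁺`. [folklore] -/
theorem tendsto_one_div_sq_nhdsGT : Tendsto (fun t : ℝ => 1 / t ^ 2) (𝓝[>] 0) atTop := by
  have h : (fun t : ℝ => 1 / t ^ 2) = (fun x : ℝ => x ^ 2) ∘ fun t => t⁻¹ := by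
    funext t; simp [inv_pow]
  rw [h]
  exact (tendsto_pow_atTop two_ne_zero).comp tendsto_inv_nhdsGT_zero

/-- **Continuous extension through `β = ∞`**: `t ↦ V(1/t²)` (`t > 0`), `ℓ` (`t ≤ 0`) is continuous
on `ℝ` when `V` is continuous on `(0, ∞)` with limit `ℓ` at `∞`. [folklore] -/
theorem continuous_extend {V : ℝ → ℝ} {ℓ : ℝ} (hV : ContinuousOn V (Set.Ioi 0))
    (hℓ : Tendsto V atTop (𝓝 ℓ)) :
    Continuous (fun t : ℝ => if 0 < t then V (1 / t ^ 2) else ℓ) := by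
  rw [continuous_iff_continuousAt]
  intro t
  rcases lt_trichotomy t 0 with ht | rfl | ht
  · have heq : (fun t : ℝ => if 0 < t then V (1 / t ^ 2) else ℓ) =ᶠ[𝓝 t] fun _ => ℓ := by
      filter_upwards [Iio_mem_nhds ht] with s hs
      rw [if_neg (not_lt.2 (le_of_lt hs))]
    exact (continuousAt_congr heq).2 continuousAt_const
  · rw [ContinuousAt, if_neg (lt_irrefl (0 : ℝ)), ← nhdsLE_sup_nhdsGT (0 : ℝ), tendsto_sup]
    constructor
    · have heq : (fun t : ℝ => if 0 < t then V (1 / t ^ 2) else ℓ) =ᶠ[𝓝[≤] (0 : ℝ)] fun _ => ℓ := by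
        filter_upwards [self_mem_nhdsWithin] with s hs
        rw [if_neg (not_lt.2 hs)]
      exact (tendsto_congr' heq).2 tendsto_const_nhds
    · have heq : (fun t : ℝ => if 0 < t then V (1 / t ^ 2) else ℓ) =ᶠ[𝓝[>] (0 : ℝ)]
          fun t => V (1 / t ^ 2) := by
        filter_upwards [self_mem_nhdsWithin] with s hs
        rw [if_pos (show 0 < s from hs)]
      exact (tendsto_congr' heq).2 (hℓ.comp tendsto_one_div_sq_nhdsGT)
  · have heq : (fun t : ℝ => if 0 < t then V (1 / t ^ 2) else ℓ) =ᶠ[𝓝 t]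
        fun t => V (1 / t ^ 2) := by
      filter_upwards [Ioi_mem_nhds ht] with s hs
      rw [if_pos (show 0 < s from hs)]
    refine (continuousAt_congr heq).2 ?_
    have h1 : ContinuousAt (fun t : ℝ => 1 / t ^ 2) t := by
      have : t ^ 2 ≠ 0 := by positivity
      fun_prop (disch := assumption)
    have h2 : ContinuousAt V (1 / t ^ 2) := hV.continuousAt (Ioi_mem_nhds (by positivity))
    exact ContinuousAt.comp_of_eq h2 h1 rfl

variable (M : ℕ) (hM : 2 ≤ M)

/-- The even-`M` junk step on the thin chart `ℝ × ℝ` (`E = ℝ`): parabolic in `g`, halving in `y`. -/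
def FE (p : ℝ × ℝ) : ℝ × ℝ := (φJ M p.1, (1 / 2 : ℝ) • p.2)

/-- The even-`M` junk step is continuous. [folklore] -/
theorem continuous_FE : Continuous (FE M) := by unfold FE φJ; fun_prop

open Classical in
/-- The even-`M` germ: on odd base tori, the Wilson data at `β = 1/g²` read through the
continuous extension; it ignores the fibre coordinate. -/
def germE (n : ℕ) (σ : Fin n → YMSpecies G) (q : ℝ × ℝ) (S₀ : ℕ)
    (f : Fin n → 𝓢(EuclideanSpace ℝ (Fin 4), ℝ)) : ℝ :=
  if Odd S₀ then
    (if 0 < q.1 then wilsonCentredSchwinger r.ρ (1 / q.1 ^ 2) ((S₀ - 1) / 2) (cInd r) n σ f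
      else Classical.choose (regular_cInd r ((S₀ - 1) / 2) n σ f).2)
  else 0

/-- The even-`M` germ is continuous in the chart point. [folklore] -/
theorem continuous_germE (n : ℕ) (σ : Fin n → YMSpecies G)
    (S₀ : ℕ) (f : Fin n → 𝓢(EuclideanSpace ℝ (Fin 4), ℝ)) :
    Continuous fun q : ℝ × ℝ => germE r n σ q S₀ f := by
  unfold germE
  by_cases hS : Odd S₀
  · simp only [hS, ↓reduceIte]
    have h := continuous_extend (regular_cInd r ((S₀ - 1) / 2) n σ f).1
      (Classical.choose_spec (regular_cInd r ((S₀ - 1) / 2) n σ f).2)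
    exact h.comp continuous_fst
  · simp only [hS, ↓reduceIte]
    exact continuous_const

include hM

/-- The even-`M` junk realisation functional. -/
def expectE (n : ℕ) (σ : Fin n → YMSpecies G) (p : ℝ × ℝ)
    (S : ℕ) (f : Fin n → 𝓢(EuclideanSpace ℝ (Fin 4), ℝ)) : ℝ :=
  orbitRec M (FE M) (contractTuple M) (germE r n σ) hM p S f

/-- (4a) holds identically for the even-`M` functional. [folklore] -/
theorem expectE_step (n : ℕ) (σ : Fin n → YMSpecies G)
    (p : ℝ × ℝ) (S : ℕ) (f : Fin n → 𝓢(EuclideanSpace ℝ (Fin 4), ℝ)) :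
    expectE r M hM n σ (FE M p) S f =
      expectE r M hM n σ p (M * S) (fun i => blockDilate M (f i)) := by
  have hM0 : M ≠ 0 := by omega
  by_cases hS : S = 0
  · subst hS
    unfold expectE
    rw [mul_zero, orbitRec_of_not _ _ _ hM _ 0 _ (by simp), orbitRec_of_not _ _ _ hM _ 0 _ (by simp)]
    simp [germE]
  · unfold expectE
    rw [orbitRec_mul _ _ _ hM p hS]
    congr 1
    funext i
    exact (blockContract_blockDilate hM0 (f i)).symm

/-- (4b) for the even-`M` functional: Wilson data at `β = 1/g²` on odd tori (`M` even). [folklore] -/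
theorem expectE_wilson (hMe : Even M) (n : ℕ)
    (σ : Fin n → YMSpecies G) {g : ℝ} (hg : 0 < g) (y : ℝ) (L : ℕ)
    (f : Fin n → 𝓢(EuclideanSpace ℝ (Fin 4), ℝ)) :
    expectE r M hM n σ (g, y) (2 * L + 1) f =
      wilsonCentredSchwinger r.ρ (1 / g ^ 2) L (cInd r) n σ f := by
  unfold expectE
  have hnd : ¬ (2 * L + 1 ≠ 0 ∧ M ∣ 2 * L + 1) := by
    rintro ⟨-, hd⟩
    have : Even (2 * L + 1) := (even_iff_two_dvd.2 ((even_iff_two_dvd.1 hMe).trans hd))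
    exact Nat.not_even_iff_odd.2 ⟨L, rfl⟩ this
  rw [orbitRec_of_not _ _ _ hM _ _ _ hnd]
  unfold germE
  rw [if_pos ⟨L, rfl⟩, if_pos hg]
  congr 1
  omega

/-- The even-`M` functional is continuous in the chart point (continuity through the recursion). [folklore] -/
theorem continuous_expectE (n : ℕ) (σ : Fin n → YMSpecies G)
    (S : ℕ) (f : Fin n → 𝓢(EuclideanSpace ℝ (Fin 4), ℝ)) :
    Continuous fun p : ℝ × ℝ => expectE r M hM n σ p S f := by
  unfold expectE
  induction S using Nat.strong_induction_on generalizing f with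
  | _ S ih =>
    by_cases h : S ≠ 0 ∧ M ∣ S
    · obtain ⟨S', rfl⟩ := h.2
      have hS' : S' ≠ 0 := by rintro rfl; exact h.1 (by simp)
      have hlt : S' < M * S' := by
        have : 1 * S' < M * S' := Nat.mul_lt_mul_of_pos_right (by omega) (Nat.pos_of_ne_zero hS')
        simpa using this
      simp_rw [orbitRec_mul _ _ _ hM _ hS']
      exact (ih S' hlt (contractTuple M f)).comp (continuous_FE M)
    · simp_rw [orbitRec_of_not _ _ _ hM _ S _ h]
      exact continuous_germE r n σ S f

/-- **The even-`M` junk inhabitant of the FULL structure** (re-proved, unconditional): thin chart `E = ℝ`, `g ↦ g + (log M) g³`, `y ↦ y/2`, `yW ≡ 1`,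
`betaOf = 1/g²`, `c = cInd`, functional `expectE`. For even `M` the only pinned points are the
Wilson arc itself (`M ∤ 2L+1`), so (4c) reduces to finite-torus regularity: NO renormalisation-group
content. [folklore] -/
def evenStep (hMe : Even M) : BalabanBanachStep G r M where
  E := ℝ
  φ g _ := φJ M g
  Ψ _ y := (1 / 2 : ℝ) • y
  A := (1 / 2 : ℝ) • ContinuousLinearMap.id ℝ ℝ
  b := Real.log M
  θ := 1 / 2
  C := 1
  δ := 1
  b_pos := Real.log_pos (by exact_mod_cast hM)
  θ_nonneg := by norm_num
  θ_lt_one := by norm_num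
  C_pos := one_pos
  δ_pos := one_pos
  norm_A_le := norm_half_id_le'
  remainder g y _ _ := by
    constructor
    · simp only [φJ, sub_self, abs_zero]; positivity
    · rw [half_id_apply', sub_self, norm_zero]; positivity
  lipschitz_fibre g y y' _ _ _ := by
    constructor
    · simp only [sub_self, abs_zero]; positivity
    · have : (1 / 2 : ℝ) • y - (1 / 2 : ℝ) • y' -
          ((1 / 2 : ℝ) • ContinuousLinearMap.id ℝ ℝ) (y - y') = 0 := by
        rw [half_id_apply', smul_sub]
        abel
      rw [this, norm_zero]; positivity
  lipschitz_base g g' y _ _ _ := by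
    constructor
    · have : φJ M g - φJ M g' - (g - g') - Real.log M * (g ^ 3 - g' ^ 3) = 0 := by
        simp only [φJ]; ring
      rw [this, abs_zero]; positivity
    · simp only [sub_self, norm_zero]; positivity
  b₀ := 1
  b_eq := (one_mul _).symm
  R := 1
  δ_le_R := le_rfl
  θ' := 1 / 2
  θ'_nonneg := by norm_num
  θ'_lt_one := by norm_num
  contraction g y y' _ _ _ := by
    rw [← smul_sub, norm_smul]; norm_num
  remainder_basin g y _ _ := by simp only [φJ, sub_self, abs_zero]; positivity
  yW _ := 1
  g₀ := 1
  g₀_pos := one_pos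
  continuousOn_yW := continuousOn_const
  norm_yW_le _ _ := by simp
  betaOf g := 1 / g ^ 2
  strictAntiOn_betaOf := strictAntiOn_one_div_sq
  continuousOn_betaOf := continuousOn_one_div_sq
  κ := 1
  κ_pos := one_pos
  K := 0
  betaOf_sub_le g _ := by simp
  c _ := cInd r
  c_curvature _ := cInd_curvature r
  expect p S n σ f := expectE r M hM n σ p S f
  expect_step g y _ _ S n σ f := expectE_step r M hM n σ (g, y) S f
  expect_wilson g hg L n σ f := expectE_wilson r M hM hMe n σ hg.1 1 L f
  continuousOn_expect S n σ f _ := (continuous_expectE r M hM n σ S f).continuousOn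

/-- **Even `M` is dead weight.** For every compact `G`, every lattice representation `r` and every EVEN
`M ≥ 2`, `BalabanBanachStep G r M` is inhabited with zero renormalisation-group content. [folklore] -/
theorem nonempty_of_even (hMe : Even M) :
    Nonempty (BalabanBanachStep G r M) := ⟨evenStep r M hM hMe⟩

end Even


/-! ### The crux is equivalent to its restriction to odd block factors -/

/-- **`BalabanStepParabolic ↔` (its restriction to ODD `M`)**, unconditionally: the even half of
"`∀ M ≥ M₀`" carries no content (each even `M ≥ 2` is inhabited by `nonempty_of_even`). PLANNER: restate
the crux with `Odd M →` (equivalent, cosmetic) or let (4b) pin ALL tori. [folklore] -/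
theorem balabanStepParabolic_iff_odd :
    Summit.QuantumFields.YangMills.Theses.ParabolicTrajectory.BalabanStepParabolic ↔
      ∀ (G : Type) [Group G] [TopologicalSpace G] [IsTopologicalGroup G] [CompactSpace G],
        IsCompactSimpleLieGroup G → letI : MeasurableSpace G := borel G; haveI : BorelSpace G := ⟨rfl⟩;
        ∀ (r : LatticeRep G), ∃ M₀ : ℕ, ∀ M : ℕ, M₀ ≤ M → Odd M → Nonempty (BalabanBanachStep G r M) := by
  constructor
  · intro h G _ _ _ _ hG r
    obtain ⟨M₀, hM₀⟩ := h G hG r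
    exact ⟨M₀, fun M hM _ => hM₀ M hM⟩
  · intro h G _ _ _ _ hG r
    letI : MeasurableSpace G := borel G
    haveI : BorelSpace G := ⟨rfl⟩
    obtain ⟨M₀, hM₀⟩ := h G hG r
    refine ⟨max M₀ 2, fun M hM => ?_⟩
    have h2 : 2 ≤ M := (le_max_right _ _).trans hM
    rcases Nat.even_or_odd M with he | ho
    · exact nonempty_of_even r M h2 he
    · exact hM₀ M ((le_max_left _ _).trans hM) ho

/-- **The even half of the crux is a theorem** (for the record, in the crux's own quantifier shape). [folklore] -/
theorem balabanStepParabolic_even_half :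
    ∀ (G : Type) [Group G] [TopologicalSpace G] [IsTopologicalGroup G] [CompactSpace G],
      IsCompactSimpleLieGroup G → letI : MeasurableSpace G := borel G; haveI : BorelSpace G := ⟨rfl⟩;
      ∀ (r : LatticeRep G), ∃ M₀ : ℕ, ∀ M : ℕ, M₀ ≤ M → Even M → Nonempty (BalabanBanachStep G r M) := by
  intro G _ _ _ _ _ r
  letI : MeasurableSpace G := borel G
  haveI : BorelSpace G := ⟨rfl⟩
  exact ⟨2, fun M hM he => nonempty_of_even r M hM he⟩

end

end Summit.QuantumFields.YangMills.Theorems.BalabanStepParabolic.Negative
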